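import Literature.Geometry.Riemannian.HeatGradientSubsolution
import Literature.Geometry.Lorentzian.CoordScalarGradientEvolution
import Literature.Geometry.Lorentzian.CoordConjugateHeat
import Literature.Geometry.Riemannian.RicciFlowCurvatureBlowupJunction
import HarnessLib

/-!
# Hamilton's quotient `|∇u|²/u` is a subsolution of the heat equation along a Ricci flow

For a POSITIVE solution `u` of the heat equation `∂ₜu = Δ_{g(t)} u` coupled with a Ricci flow
`∂ₜg = −2 Ric`, the function `ψ = |∇u|²/u` satisfies

  `∂ₜψ = Δψ − (2/u)·|Hess u − (du ⊗ du)/u|² ≤ Δψ`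

(Hamilton's quotient trick, Hamilton 1982 §11 Lemma 11.4 — there for `|∇R|²/R` with the extra
reaction term of `∂ₜR = ΔR + 2|Ric|²`; here for the heat equation, where no reaction term is
left). Integrated against the conjugate heat kernel it gives Hein–Naber's gradient bound
`|∇P f|²/P f ≤ P(|∇f|²/f)` for the heat semigroup of a Ricci flow and their log-Sobolev inequality
for conjugate heat kernel measures (Hein–Naber 2014, Thm. 1.10; Bamler 2020a, §4.2 and §12).
The computation: with `w = |∇u|²`, `□ = ∂ₜ − Δ`, one has `□u = 0`, `□w = −2|Hess u|²`
(`HeatGradientSubsolution.lean`), `Δ(ψ·u) = ψΔu + uΔψ + 2⟨∇ψ, ∇u⟩` and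
`⟨∇w, ∇u⟩ = 2 Hess u(∇u, ∇u)`, whence
`□ψ = −(2/u³)·(u²|Hess u|² − 2u·Hess u(∇u, ∇u) + |∇u|⁴) = −(2/u³)|u·Hess u − du ⊗ du|² ≤ 0`.

Contents (everything proved; no definitions, no named facts):

* `MetricCoord.IsMetricOn.two_mul_apply_sharpAt_le` — Hamilton's square expanded:
  `2a·H(♯θ, ♯θ) ≤ a²|H|² + θ(♯θ)²` for a symmetric form `H` at a positive definite point;
* `MetricCoord.IsMetricFamilyOn.derivWithin_gradSqAt_div_eq_of_heat`, `…_le_of_heat` — the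
  identity and the inequality in coordinates, for a coordinate Ricci flow `∂G/∂t = −2Ric(G)` and
  `v > 0` solving `∂ₜv = Δ_{G t} v` on the coordinate patch (from
  `tDerivFun_gradSqAt_eq_of_heat`, `HeatGradientSubsolution.lean`, the product rule `lapAt_mul`,
  `CoordConjugateHeat.lean`, and the square completion of `CoordScalarGradientEvolution.lean`);
* `derivWithin_gradSq_div_le_of_heat_ricciFlow` — the inequality
  `∂ₜ(|∇u|²_{g(t)}/u)(x) ≤ Δ_{g(t)}(|∇u|²_{g(t)}/u)(x)` on a manifold with boundaryless
  finite-dimensional model, for a Ricci flow of Riemannian metrics on `[s, t]`, `s < t`, and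
  `u > 0` `C^∞` on `M × [s, t]` solving the heat equation (one-sided time derivatives at the end
  points), transported through the chart at `x` exactly as
  `derivWithin_gradSq_le_of_heat_ricciFlow` (`HeatGradientSubsolution.lean`).

What is NOT here: the integrated consequences (`|∇P f|²/P f ≤ P(|∇f|²/f)`, the log-Sobolev and
Gaussian concentration inequalities for conjugate heat kernel measures, Hein–Naber Thm. 1.10 /
Bamler 2020a §12), super Ricci flows `∂ₜg ≥ −2Ric` (the tree's flow layer is the Ricci flow
equation), and the matrix (Li–Yau–Hamilton) versions.

## References

* H.-J. Hein, A. Naber, *New logarithmic Sobolev inequalities and an ε-regularity theorem for the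
  Ricci flow*, Comm. Pure Appl. Math. 67 (2014), 1543–1561, Thm. 1.10 and its proof.
  [HeinNaber2014]
* R. H. Bamler, *Entropy and heat kernel bounds on a Ricci flow background*, arXiv:2008.07093
  (2020), §4.2 (proof of Thm. 4.1), §12. [Bamler2020Entropy]
* R. S. Hamilton, *Three-manifolds with positive Ricci curvature*, J. Differential Geom. 17 (1982)
  255–306, §11, Lemma 11.4. [Hamilton1982]
* P. Topping, *Lectures on the Ricci flow*, LMS Lecture Note Series 325, CUP 2006, proof of
  Prop. 8.2.6 (Bochner formula under the flow, product rule for `Δ`). [Topping2006]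
-/

noncomputable section

set_option maxSynthPendingDepth 3

open Set Filter Function
open scoped Topology ContDiff Manifold

namespace Literature.Geometry.Lorentzian

namespace MetricCoord

/-! ## Hamilton's square `|a·H − θ ⊗ θ|² ≥ 0`, expanded -/

namespace IsMetricOn

variable {E : Type*} [NormedAddCommGroup E] [NormedSpace ℝ E] [FiniteDimensional ℝ E]
  {G : E → E →L[ℝ] E →L[ℝ] ℝ} {V : Set E} {x : E}

/-- **Hamilton's square, expanded**: for a symmetric form `H` at a positive definite point, a
covector `θ` and a real number `a`, `2a·H(♯θ, ♯θ) ≤ a²|H|²_G + θ(♯θ)²` — the expansion of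
`0 ≤ |a·H − θ ⊗ θ|²_G` (`⟨H, θ ⊗ θ⟩ = H(♯θ, ♯θ)`, `|θ ⊗ θ|² = θ(♯θ)²`), from the Cauchy–Schwarz
inequality `|H(w, w)| ≤ √|H|² · G(w, w)` (`abs_apply_apply_le_sqrt_normSqAt_mul`).
[cite: Hamilton1982, §11, Lemma 11.4] -/
theorem two_mul_apply_sharpAt_le (hG : IsMetricOn G V) (hx : x ∈ V)
    (hpos : ∀ v : E, v ≠ 0 → 0 < G x v v) {H : E →L[ℝ] E →L[ℝ] ℝ} (hH : ∀ v w, H v w = H w v)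
    (θ : E →L[ℝ] ℝ) (a : ℝ) :
    2 * a * H (sharpAt G x θ) (sharpAt G x θ) ≤
      a ^ 2 * normSqAt G x H + θ (sharpAt G x θ) ^ 2 := by
  set w : E := sharpAt G x θ
  have hHn : 0 ≤ normSqAt G x H := hG.normSqAt_nonneg_of_symm' hx hpos hH
  have hCS : |H w w| ≤ Real.sqrt (normSqAt G x H) * G x w w :=
    hG.abs_apply_apply_le_sqrt_normSqAt_mul hx hpos hH w
  rw [apply_sharpAt_apply (hG.isInvertible x hx)] at hCS
  have h1 : a * H w w ≤ |a| * (Real.sqrt (normSqAt G x H) * θ w) := by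
    calc a * H w w ≤ |a * H w w| := le_abs_self _
      _ = |a| * |H w w| := abs_mul a _
      _ ≤ |a| * (Real.sqrt (normSqAt G x H) * θ w) :=
        mul_le_mul_of_nonneg_left hCS (abs_nonneg a)
  nlinarith [sq_nonneg (|a| * Real.sqrt (normSqAt G x H) - θ w), Real.sq_sqrt hHn, sq_abs a]

end IsMetricOn

/-! ## The coordinate computation: `∂ₜ(|∇v|²/v) = Δ(|∇v|²/v) − (2/v³)|v·Hess v − dv ⊗ dv|²` -/

namespace IsMetricFamilyOn

variable {E : Type*} [NormedAddCommGroup E] [NormedSpace ℝ E] [FiniteDimensional ℝ E]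
  [CompleteSpace E] {G : ℝ → E → E →L[ℝ] E →L[ℝ] ℝ} {S : Set ℝ} {V : Set E} {x : E} {t : ℝ}
  {v : ℝ → E → ℝ}

variable (hG : IsMetricFamilyOn G S V)
  (hfl : ∀ s ∈ S, ∀ y ∈ V, tDeriv G S s y = (-2 : ℝ) • ricAt (G s) y)
include hG hfl

/-- **The evolution of Hamilton's quotient `|∇v|²/v` for a positive heat solution along a
coordinate Ricci flow** (the exact identity): let `G` solve `∂G/∂t = −2 Ric(G)` on `V × S` and
`v`, `C^∞` on `V × S`, solve at time `t` on `V` the heat equation `∂ₜv = Δ_{G t} v`, with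
`v t > 0` on `V`. Then at `x ∈ V`, with `w = ♯dv`, `H = Hess v`,

  `∂ₜ(|∇v|²/v) = Δ(|∇v|²/v) − (2/v³)·(v²|H|² − 2v·H(w, w) + |∇v|⁴)`,

the bracket being `|v·Hess v − dv ⊗ dv|²` (from `∂ₜ|∇v|² = Δ|∇v|² − 2|Hess v|²`,
`tDerivFun_gradSqAt_eq_of_heat`, the quotient rule in time, and
`Δ(ψ·v) = ψΔv + vΔψ + 2Dψ(♯dv)`, `lapAt_mul`, for `ψ = |∇v|²/v`). The derivative is `derivWithin`
over `S` (one-sided at end points). [cite: Hamilton1982, §11, Lemma 11.4]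
[cite: HeinNaber2014, proof of Thm. 1.10] -/
theorem derivWithin_gradSqAt_div_eq_of_heat
    (hv : ContDiffOn ℝ ∞ (fun p : E × ℝ ↦ v p.2 p.1) (V ×ˢ S)) (hx : x ∈ V) (ht : t ∈ S)
    (hveq : ∀ y ∈ V, tDerivFun v S t y = lapAt (G t) (v t) y) (hvpos : ∀ y ∈ V, 0 < v t y) :
    derivWithin (fun s ↦ gradSqAt (G s) (v s) x / v s x) S t =
      lapAt (G t) (fun y ↦ gradSqAt (G t) (v t) y / v t y) x
        - 2 / v t x ^ 3 *
          (v t x ^ 2 * normSqAt (G t) x (hessAt (G t) (v t) x)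
            - 2 * v t x * hessAt (G t) (v t) x (sharpAt (G t) x (fderiv ℝ (v t) x))
                (sharpAt (G t) x (fderiv ℝ (v t) x))
            + gradSqAt (G t) (v t) x ^ 2) := by
  have hGt := hG.isMetricOn t ht
  have hV := hG.isOpen ht
  have hi := hGt.isInvertible x hx
  have hsym := hGt.symm x hx
  -- notation
  set Uf : E → ℝ := v t with hUf
  set Wf : E → ℝ := gradSqAt (G t) Uf with hWf
  set φ : E →L[ℝ] ℝ := fderiv ℝ Uf x with hφ
  set w : E := sharpAt (G t) x φ with hw
  set Hs : E →L[ℝ] E →L[ℝ] ℝ := hessAt (G t) Uf x with hHs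
  have hUx : 0 < Uf x := hvpos x hx
  have hUne : Uf x ≠ 0 := hUx.ne'
  -- regularity
  have hUcont : ContDiffOn ℝ ∞ Uf V := contDiffOn_of_family hv ht
  have hWcont : ContDiffOn ℝ ∞ Wf V := hGt.contDiffOn_gradSqAt hUcont
  have hqcont : ContDiffOn ℝ ∞ (fun y ↦ Wf y / Uf y) V :=
    hWcont.div hUcont fun y hy ↦ (hvpos y hy).ne'
  have hU2 : ContDiffAt ℝ 2 Uf x := (hUcont.contDiffAt (hV.mem_nhds hx)).of_le (by norm_cast)
  have hq2 : ContDiffAt ℝ 2 (fun y ↦ Wf y / Uf y) x :=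
    (hqcont.contDiffAt (hV.mem_nhds hx)).of_le (by norm_cast)
  have hWd : DifferentiableAt ℝ Wf x := hGt.differentiableAt_gradSqAt hx hUcont
  have hUd : DifferentiableAt ℝ Uf x := hU2.differentiableAt (by simp)
  -- (1) the time derivatives of `|∇v|²` and `v` at `x`, and of the quotient
  have hWt : HasDerivWithinAt (fun s ↦ gradSqAt (G s) (v s) x)
      (lapAt (G t) Wf x - 2 * normSqAt (G t) x Hs) S t := by
    have h0 := (hG.hasDerivWithinAt_gradSqAt_ricciFlow hfl hv hx
      ht).differentiableWithinAt.hasDerivWithinAt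
    have h1 := hG.tDerivFun_gradSqAt_eq_of_heat hfl hv hx ht hveq
    rw [tDerivFun] at h1
    rwa [h1] at h0
  have hUt : HasDerivWithinAt (fun s ↦ v s x) (lapAt (G t) Uf x) S t := by
    have h0 := hasDerivWithinAt_of_family hv hx ht
    rwa [hveq x hx] at h0
  have hgoal : derivWithin (fun s ↦ gradSqAt (G s) (v s) x / v s x) S t =
      ((lapAt (G t) Wf x - 2 * normSqAt (G t) x Hs) * Uf x
        - Wf x * lapAt (G t) Uf x) / Uf x ^ 2 := by
    have h : HasDerivWithinAt (fun s ↦ gradSqAt (G s) (v s) x / v s x)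
        (((lapAt (G t) Wf x - 2 * normSqAt (G t) x Hs) * Uf x
          - Wf x * lapAt (G t) Uf x) / Uf x ^ 2) S t := hWt.div hUt hUne
    exact h.derivWithin (hG.uniqueDiffOn t ht)
  rw [hgoal]
  -- (2) the Laplacian of the quotient from the product rule `Δ(ψ·v)`
  have hprod : lapAt (G t) (fun y ↦ (Wf y / Uf y) * Uf y) x =
      (Wf x / Uf x) * lapAt (G t) Uf x + Uf x * lapAt (G t) (fun y ↦ Wf y / Uf y) x
        + 2 * fderiv ℝ (fun y ↦ Wf y / Uf y) x w :=
    lapAt_mul (G t) hi hsym hq2 hU2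
  have hcongr : lapAt (G t) (fun y ↦ (Wf y / Uf y) * Uf y) x = lapAt (G t) Wf x := by
    refine lapAt_congr_of_eventuallyEq (G t) ?_
    filter_upwards [hV.mem_nhds hx] with y hy
    exact div_mul_cancel₀ (Wf y) (hvpos y hy).ne'
  -- the differential of the quotient along `♯dv`
  have hdu : fderiv ℝ (fun y ↦ Wf y / Uf y) x w =
      (2 * Hs w w) / Uf x - Wf x * Wf x / Uf x ^ 2 := by
    have hinv : HasFDerivAt (fun y ↦ (Uf y)⁻¹)
        ((ContinuousLinearMap.toSpanSingleton ℝ (-(Uf x ^ 2)⁻¹)).comp (fderiv ℝ Uf x)) x :=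
      (hasFDerivAt_inv hUne).comp x hUd.hasFDerivAt
    have h := (hWd.hasFDerivAt.mul hinv).fderiv
    have heq : (fun y ↦ Wf y / Uf y) = fun y ↦ Wf y * (Uf y)⁻¹ := by
      funext y; rw [div_eq_mul_inv]
    rw [heq, show (fun y ↦ Wf y * (Uf y)⁻¹) = (Wf * fun y ↦ (Uf y)⁻¹) from rfl, h]
    simp only [_root_.add_apply, _root_.smul_apply, smul_eq_mul, ContinuousLinearMap.comp_apply,
      ContinuousLinearMap.toSpanSingleton_apply]
    have hDW : fderiv ℝ Wf x w = 2 * Hs w w := by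
      rw [hWf, hGt.fderiv_gradSqAt hx hUcont w]
    have hDU : fderiv ℝ Uf x w = Wf x := by
      rw [hw, hφ, hWf, gradSqAt_apply]
    rw [hDW, hDU]
    field_simp
    ring
  rw [hcongr] at hprod
  -- solve `hprod` for `Δ(|∇v|²/v)`
  have hlapu : lapAt (G t) (fun y ↦ Wf y / Uf y) x =
      (lapAt (G t) Wf x - (Wf x / Uf x) * lapAt (G t) Uf x
        - 2 * ((2 * Hs w w) / Uf x - Wf x * Wf x / Uf x ^ 2)) / Uf x := by
    rw [← hdu, eq_div_iff hUne]
    linarith [hprod]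
  rw [hlapu]
  field_simp
  ring

/-- **Hamilton's quotient `|∇v|²/v` is a subsolution of the heat equation along a coordinate
Ricci flow**: under the hypotheses of `derivWithin_gradSqAt_div_eq_of_heat`, if moreover `G t x`
is positive definite, then

  `∂ₜ(|∇v|²/v) ≤ Δ(|∇v|²/v)`

(the defect `(2/v³)|v·Hess v − dv ⊗ dv|² = (2/v³)(v²|H|² − 2v·H(w,w) + |∇v|⁴)` is nonnegative,
`IsMetricOn.two_mul_apply_sharpAt_le`). [cite: Hamilton1982, §11, Lemma 11.4]
[cite: HeinNaber2014, proof of Thm. 1.10] [cite: Bamler2020Entropy, §4.2, proof of Thm. 4.1] -/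
theorem derivWithin_gradSqAt_div_le_of_heat
    (hv : ContDiffOn ℝ ∞ (fun p : E × ℝ ↦ v p.2 p.1) (V ×ˢ S)) (hx : x ∈ V) (ht : t ∈ S)
    (hveq : ∀ y ∈ V, tDerivFun v S t y = lapAt (G t) (v t) y)
    (hposdef : ∀ e : E, e ≠ 0 → 0 < G t x e e) (hvpos : ∀ y ∈ V, 0 < v t y) :
    derivWithin (fun s ↦ gradSqAt (G s) (v s) x / v s x) S t ≤
      lapAt (G t) (fun y ↦ gradSqAt (G t) (v t) y / v t y) x := by
  have hGt := hG.isMetricOn t ht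
  have hV := hG.isOpen ht
  rw [hG.derivWithin_gradSqAt_div_eq_of_heat hfl hv hx ht hveq hvpos, sub_le_self_iff]
  have hUx : 0 < v t x := hvpos x hx
  have hHsym : ∀ a b, hessAt (G t) (v t) x a b = hessAt (G t) (v t) x b a := fun a b ↦
    hGt.hessAt_comm hx ((contDiffOn_of_family hv ht).contDiffAt (hV.mem_nhds hx)) a b
  have hsq := hGt.two_mul_apply_sharpAt_le hx hposdef hHsym (fderiv ℝ (v t) x) (v t x)
  rw [← gradSqAt_apply] at hsq
  exact mul_nonneg (by positivity) (by linarith [hsq])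

end IsMetricFamilyOn

end MetricCoord

end Literature.Geometry.Lorentzian

/-! ## The inequality `∂ₜ(|∇u|²/u) ≤ Δ(|∇u|²/u)` on the manifold -/

namespace Literature.Geometry.Riemannian

open Lorentzian Lorentzian.PseudoRiemannianMetric

variable {E : Type*} [NormedAddCommGroup E] [NormedSpace ℝ E] [FiniteDimensional ℝ E]
  [CompleteSpace E] {H : Type*} [TopologicalSpace H] {I : ModelWithCorners ℝ E H} [I.Boundaryless]
  {M : Type*} [TopologicalSpace M] [ChartedSpace H M] [IsManifold I ∞ M]
  {g : ℝ → PseudoRiemannianMetric I ∞ E (TangentSpace I : M → Type _)}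
  {cov : ℝ → CovariantDerivative I E (TangentSpace I : M → Type _)}

/-- **Hamilton's quotient `|∇u|²/u` is a subsolution of the heat equation along a Ricci flow**
(Hein–Naber 2014, proof of Thm. 1.10; Bamler 2020a, §4.2 and §12; Hamilton's trick, 1982, §11,
Lemma 11.4, for the heat equation in place of `∂ₜR = ΔR + 2|Ric|²`). Let `(g, cov)` be a Ricci
flow of Riemannian metrics on `[s, t]`, `s < t`, on a manifold with boundaryless
finite-dimensional model (no compactness needed), and `u > 0` a solution of the heat equation
`∂ₜu = Δ_{g(r)} u`, `C^∞` on `M × [s, t]` (one-sided time derivatives at the end points). Then at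
every `(x, r) ∈ M × [s, t]`

  `∂ₜ (|∇u|²_{g(r)}/u) (x) ≤ Δ_{g(r)} (|∇u|²_{g(r)}/u) (x)`

(indeed `∂ₜψ = Δψ − (2/u)|Hess u − du ⊗ du/u|²` for `ψ = |∇u|²/u`: read the flow and `u` in the
chart at `x` — `IsRicciFlow.isMetricFamilyOn_chartRep_Icc`, `tDeriv_chartRep_eq_Icc`,
`lapAt_chartRep_eq`, `gradSqAt_chartRep_eq` — and apply
`MetricCoord.IsMetricFamilyOn.derivWithin_gradSqAt_div_le_of_heat`). It yields Hein–Naber's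
`|∇P f|²/P f ≤ P(|∇f|²/f)` and their log-Sobolev inequality for conjugate heat kernel measures.
[cite: HeinNaber2014, proof of Thm. 1.10] [cite: Bamler2020Entropy, §4.2, proof of Thm. 4.1]
[cite: Hamilton1982, §11, Lemma 11.4] -/
theorem derivWithin_gradSq_div_le_of_heat_ricciFlow {s t : ℝ} (hst : s < t)
    (h : IsRicciFlow g cov (Icc s t)) (hR : ∀ r ∈ Icc s t, (g r).IsRiemannian)
    {u : ℝ → M → ℝ}
    (hu : ContMDiffOn (I.prod 𝓘(ℝ, ℝ)) 𝓘(ℝ, ℝ) ∞ (fun p : M × ℝ ↦ u p.2 p.1) (univ ×ˢ Icc s t))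
    (hueq : ∀ r ∈ Icc s t, ∀ x : M,
      HasDerivWithinAt (fun r' ↦ u r' x) ((g r).laplaceBeltrami (u r) x) (Icc s t) r)
    (hupos : ∀ r ∈ Icc s t, ∀ x : M, 0 < u r x)
    {r : ℝ} (hr : r ∈ Icc s t) (x : M) :
    derivWithin (fun r' ↦ (g r').gradSq (u r') x / u r' x) (Icc s t) r ≤
      (g r).laplaceBeltrami (fun y ↦ (g r).gradSq (u r) y / u r y) x := by
  have h2 : (2 : ℕ∞ω) ≤ ∞ := WithTop.coe_le_coe.mpr le_top
  have hS : UniqueDiffOn ℝ (Icc s t) := uniqueDiffOn_Icc hst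
  have hVopen : IsOpen (extChartAt I x).target := isOpen_extChartAt_target x
  -- (1) the flow read in the chart at `x`
  have hfam := h.isMetricFamilyOn_chartRep_Icc hst x
  have hfl : ∀ r' ∈ Icc s t, ∀ y ∈ (extChartAt I x).target,
      MetricCoord.tDeriv (chartRep I g x) (Icc s t) r' y =
        (-2 : ℝ) • MetricCoord.ricAt (chartRep I g x r') y := fun r' hr' y hy ↦
    h.tDeriv_chartRep_eq_Icc hst x hr' hy
  -- (2) `u` read in the chart
  set uc : ℝ → E → ℝ := fun r' y ↦ u r' ((extChartAt I x).symm y)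
  have huc_smooth : ContDiffOn ℝ ∞ (fun q : E × ℝ ↦ uc q.2 q.1)
      ((extChartAt I x).target ×ˢ Icc s t) :=
    contDiffOn_chart_of_contMDiffOn_source_prod (k := (⊤ : ℕ∞)) (w := u) x
      (hu.mono (prod_mono (subset_univ _) Subset.rfl))
  have huslice : ∀ r' ∈ Icc s t, ContMDiff I 𝓘(ℝ, ℝ) ∞ (u r') := fun r' hr' ↦
    contMDiff_slice_of_contMDiffOn hu hr'
  have huct : ∀ r' ∈ Icc s t, ContDiffOn ℝ ∞ (uc r') (extChartAt I x).target := fun r' hr' ↦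
    MetricCoord.contDiffOn_of_family huc_smooth hr'
  have huc2 : ∀ r' ∈ Icc s t, ∀ y : chartTarget I x, ContDiffAt ℝ 2 (uc r') y := fun r' hr' y ↦
    ((huct r' hr').contDiffAt (hVopen.mem_nhds y.2)).of_le h2
  have hurep : ∀ r', ∀ y : chartTarget I x, u r' (chartInv I x y) = uc r' y := fun r' y ↦ rfl
  have hucpos : ∀ r' ∈ Icc s t, ∀ y ∈ (extChartAt I x).target, 0 < uc r' y := fun r' hr' y _ ↦
    hupos r' hr' _
  -- (3) the heat equation read in the chart, on `target × [s, t]`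
  have hueqc : ∀ r' ∈ Icc s t, ∀ y ∈ (extChartAt I x).target,
      MetricCoord.tDerivFun uc (Icc s t) r' y =
        MetricCoord.lapAt (chartRep I g x r') (uc r') y := by
    intro r' hr' y hy
    have hΔ := lapAt_chartRep_eq g x r' ⟨y, hy⟩ (hurep r') (((huslice r' hr') _).of_le h2)
      (huc2 r' hr' ⟨y, hy⟩)
    rw [MetricCoord.tDerivFun, hΔ]
    exact (hueq r' hr' _).derivWithin (hS r' hr')
  -- (4) the coordinate inequality at `(φ x, r)`
  have hy₀ : extChartAt I x x ∈ (extChartAt I x).target := mem_extChartAt_target x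
  have hposdef : ∀ e : E, e ≠ 0 → 0 < chartRep I g x r (extChartAt I x x) e e := fun e he ↦
    chartRep_posDef g x r (hR r hr) ⟨_, hy₀⟩ e he
  have key := hfam.derivWithin_gradSqAt_div_le_of_heat hfl (v := uc) huc_smooth hy₀ hr
    (hueqc r hr) hposdef (hucpos r hr)
  -- (5) transport of each term back to `x`
  set u₀ : chartTarget I x := ⟨extChartAt I x x, hy₀⟩
  have hΦ0 : chartInv I x u₀ = x := extChartAt_to_inv x
  have hGt := hfam.isMetricOn r hr
  -- (a) `|∇u_{r'}|²(x) = gradSqAt (G r') (uc r') (φ x)` and `u_{r'}(x) = uc r' (φ x)`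
  have hgrad : ∀ r' ∈ Icc s t, (g r').gradSq (u r') x =
      MetricCoord.gradSqAt (chartRep I g x r') (uc r') (extChartAt I x x) := by
    intro r' hr'
    have h' := gradSqAt_chartRep_eq g x r' u₀ (hurep r')
      (((huslice r' hr') _).mdifferentiableAt (by simp))
      ((huc2 r' hr' u₀).differentiableAt two_ne_zero)
    rw [hΦ0] at h'
    exact h'.symm
  have hval : ∀ r', u r' x = uc r' (extChartAt I x x) := fun r' ↦ by
    rw [← hurep r' u₀, hΦ0]
  -- (b) the representative of `ψ_r = |∇u_r|²/u_r` on the chart target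
  have hW : ContMDiffOn (I.prod 𝓘(ℝ, ℝ)) 𝓘(ℝ, ℝ) ∞
      (fun p : M × ℝ ↦ (g p.2).gradSq (u p.2) p.1) (univ ×ˢ Icc s t) :=
    h.smooth.contMDiffOn_gradSq hS (f := u) hu
  have hWslice : ContMDiff I 𝓘(ℝ, ℝ) ∞ ((g r).gradSq (u r)) :=
    contMDiff_slice_of_contMDiffOn (u := fun r' y ↦ (g r').gradSq (u r') y) hW hr
  have hΨslice : ContMDiff I 𝓘(ℝ, ℝ) ∞ (fun y ↦ (g r).gradSq (u r) y / u r y) :=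
    hWslice.div₀ (huslice r hr) fun y ↦ (hupos r hr y).ne'
  have hΨrep : ∀ y : chartTarget I x,
      (fun z ↦ (g r).gradSq (u r) z / u r z) (chartInv I x y) =
        MetricCoord.gradSqAt (chartRep I g x r) (uc r) y / uc r y := by
    intro y
    have hWy := (gradSqAt_chartRep_eq g x r y (hurep r)
      (((huslice r hr) _).mdifferentiableAt (by simp))
      ((huc2 r hr y).differentiableAt two_ne_zero)).symm
    simp only [hWy, hurep r y]
  have hWc : ContDiffOn ℝ ∞ (MetricCoord.gradSqAt (chartRep I g x r) (uc r))
      (extChartAt I x).target := hGt.contDiffOn_gradSqAt (huct r hr)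
  have hΨc : ContDiffOn ℝ ∞
      (fun y ↦ MetricCoord.gradSqAt (chartRep I g x r) (uc r) y / uc r y)
      (extChartAt I x).target :=
    hWc.div (huct r hr) fun y hy ↦ (hucpos r hr y hy).ne'
  -- (c) the time derivative
  have e1 : derivWithin (fun r' ↦ (g r').gradSq (u r') x / u r' x) (Icc s t) r =
      derivWithin (fun r' ↦ MetricCoord.gradSqAt (chartRep I g x r') (uc r')
        (extChartAt I x x) / uc r' (extChartAt I x x)) (Icc s t) r := by
    refine derivWithin_congr (fun r' hr' ↦ ?_) ?_
    · rw [hgrad r' hr', hval r']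
    · rw [hgrad r hr, hval r]
  -- (d) the Laplacian of `ψ_r`
  have e2 : (g r).laplaceBeltrami (fun y ↦ (g r).gradSq (u r) y / u r y) x =
      MetricCoord.lapAt (chartRep I g x r)
        (fun y ↦ MetricCoord.gradSqAt (chartRep I g x r) (uc r) y / uc r y)
        (extChartAt I x x) := by
    have h' := lapAt_chartRep_eq g x r u₀ hΨrep
      (by rw [hΦ0]; exact (hΨslice x).of_le h2)
      (MetricCoord.contDiffAt_two_of_contDiffOn hVopen hΨc hy₀)
    rw [hΦ0] at h'
    exact h'.symm
  rw [e1, e2]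
  exact key

end Literature.Geometry.Riemannian

end
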